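import Mathlib
import HarnessLib

/-!
# The mean-square ENGINE for clustered frequencies (li-bridge g6 §4; pure, one data def `MeanSquare.dirichletBound`)

Cell rh-split, seat rh-split-li-bridge g6 (brief sha16 f79c5f09d8bcb036), card `run/shared/lean/pub/rh-split/cards/SPLIT-li-bridge.md` §13;
§4 of `HOME/rh-split-li-bridge/SketchG6.lean` sha16 ed64da7a8eb46ca1 byte-verbatim (referee rh-split-ref g3 REPLAY PASS + LABELS
2026-08-27T05:44:52Z; lead rh-split-lead g3 RULING #26 (xi)(b): «may keep `dirichletBound` data-valued — definition lane, one def»); filed by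
rh-split-typer-2 g4 as the first of two files for §§4–5 (§5 = `LiIncrBlockLaw.lean`; two files because §§4–5 exceed 400 lines), namespace
`…Splittings.LiIncrMeanSquare` with the scratch's sub-namespace `MeanSquare` (scratch `RhSplit.LiBridgeG6`).  Mathlib-only.

For the low-zero part `F_low(n) = Σ_{γ ≤ Y} a_γ sin((n+½)θ_γ)` of the Li increment under RH (`a_γ = 4m(ρ) sin(θ_γ/2) ≈ 2/γ`,
`θ_γ = 2 arctan(1/(2γ)) ∈ (0, π/2]`), the second moment over a block `n ∈ [N, N+M)` is bounded by the bilinear form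
`MeanSquare.sum_sq_le` / `sum_sq_le'`: `Σ_{n∈[N,N+M)} (Σ_j a_j sin((n+½)θ_j))² ≤ Σ_{j,k} |a_j a_k| (D_M(θ_j−θ_k)+D_M(θ_j+θ_k))/2` with
`D_M(α) = π/max(|α|, π/M)` (`MeanSquare.dirichletBound`; Dirichlet-kernel telescoping + Jordan's inequality).  LABEL (referee g3): RH-FREE
pure engine; class (li, bridge) UNCHANGED.

HONEST LABEL: «SPLITTING SEARCH over kernel-typed RH-EQUIVALENCES; a splitting A ∧ B ⟹ RH is CONDITIONAL bookkeeping unless A and B are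
both proved; nothing here bears on the truth of RH.»
-/

set_option linter.dupNamespace false

noncomputable section

open Filter Topology Finset
open scoped Real

namespace Summit.RiemannHypothesis.RiemannHypothesis.Theorems.Splittings.LiIncrMeanSquare

/-! ## §4 The mean-square ENGINE for clustered frequencies (pure; first rung of T-Li3's low-zero lemma)

For the low-zero part `F_low(n) = Σ_{γ ≤ Y} a_γ sin((n+½)θ_γ)` of the increment under RH
(`a_γ = 4m(ρ) sin(θ_γ/2) ≈ 2/γ`, `θ_γ = 2 arctan(1/(2γ)) ∈ (0, π/2]`), the second moment over a block
`n ∈ [N, N+M)` is bounded by the bilinear form below; the only ζ-input then needed is local zero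
DENSITY (pairs `γ ≠ γ'` with `|θ_γ − θ_γ'| < π/M` cost `|a_γ a_γ'|·M`, the others `π|a_γ a_γ'|/|θ_γ − θ_γ'|`).
-/

namespace MeanSquare

/-- One step of the Dirichlet-kernel telescoping: `2 sin(α/2) cos((x+½)α) = sin((x+1)α) − sin(xα)`. -/
theorem two_sin_half_mul_cos (α x : ℝ) :
    2 * Real.sin (α / 2) * Real.cos ((x + 1 / 2) * α) = Real.sin ((x + 1) * α) - Real.sin (x * α) := by
  rw [Real.sin_sub_sin]
  congr 2 <;> ring_nf

/-- `2 sin(α/2) · Σ_{n ∈ [N, N+M)} cos((n+½)α) = sin((N+M)α) − sin(Nα)`. -/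
theorem two_sin_half_mul_sum_cos (α : ℝ) (N M : ℕ) :
    2 * Real.sin (α / 2) * ∑ n ∈ Finset.Ico N (N + M), Real.cos (((n : ℝ) + 1 / 2) * α)
      = Real.sin (((N + M : ℕ) : ℝ) * α) - Real.sin ((N : ℝ) * α) := by
  rw [Finset.mul_sum, Finset.sum_Ico_eq_sum_range, show N + M - N = M by omega]
  have h := Finset.sum_range_sub (fun i : ℕ ↦ Real.sin (((N : ℝ) + i) * α)) M
  simp only [Nat.cast_zero, add_zero] at h
  push_cast
  rw [← h]
  refine Finset.sum_congr rfl fun i _ ↦ ?_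
  push_cast
  rw [two_sin_half_mul_cos α ((N : ℝ) + i)]
  ring_nf

/-- Trivial bound: `|Σ_{n ∈ [N, N+M)} cos((n+½)α)| ≤ M`. -/
theorem abs_sum_cos_le (α : ℝ) (N M : ℕ) :
    |∑ n ∈ Finset.Ico N (N + M), Real.cos (((n : ℝ) + 1 / 2) * α)| ≤ M := by
  refine (Finset.abs_sum_le_sum_abs _ _).trans ?_
  calc ∑ n ∈ Finset.Ico N (N + M), |Real.cos (((n : ℝ) + 1 / 2) * α)|
      ≤ ∑ _n ∈ Finset.Ico N (N + M), (1 : ℝ) := Finset.sum_le_sum fun n _ ↦ Real.abs_cos_le_one _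
    _ = M := by simp

/-- Dirichlet bound: `|sin(α/2)| · |Σ_{n ∈ [N, N+M)} cos((n+½)α)| ≤ 1`. -/
theorem abs_sin_half_mul_abs_sum_cos_le (α : ℝ) (N M : ℕ) :
    |Real.sin (α / 2)| * |∑ n ∈ Finset.Ico N (N + M), Real.cos (((n : ℝ) + 1 / 2) * α)| ≤ 1 := by
  have h := two_sin_half_mul_sum_cos α N M
  have h2 : |2 * Real.sin (α / 2) * ∑ n ∈ Finset.Ico N (N + M), Real.cos (((n : ℝ) + 1 / 2) * α)| ≤ 2 := by
    rw [h]
    refine (abs_sub _ _).trans ?_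
    linarith [Real.abs_sin_le_one (((N + M : ℕ) : ℝ) * α), Real.abs_sin_le_one ((N : ℝ) * α)]
  rw [abs_mul, abs_mul, abs_two] at h2
  linarith

/-- Jordan: `|sin(α/2)| ≥ |α|/π` for `|α| ≤ π`. -/
theorem abs_div_pi_le_abs_sin_half {α : ℝ} (hα : |α| ≤ Real.pi) :
    |α| / Real.pi ≤ |Real.sin (α / 2)| := by
  have hπ := Real.pi_pos
  rcases le_or_gt 0 α with h0 | h0
  · rw [abs_of_nonneg h0] at hα ⊢
    have h1 := Real.mul_le_sin (x := α / 2) (by linarith) (by linarith)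
    have h2 : 0 ≤ Real.sin (α / 2) := Real.sin_nonneg_of_nonneg_of_le_pi (by linarith) (by linarith)
    rw [abs_of_nonneg h2]
    calc α / Real.pi = 2 / Real.pi * (α / 2) := by ring
      _ ≤ Real.sin (α / 2) := h1
  · rw [abs_of_neg h0] at hα ⊢
    have h1 := Real.mul_le_sin (x := -α / 2) (by linarith) (by linarith)
    have h2 : 0 ≤ Real.sin (-α / 2) := Real.sin_nonneg_of_nonneg_of_le_pi (by linarith) (by linarith)
    have e : Real.sin (α / 2) = -Real.sin (-α / 2) := by
      rw [← Real.sin_neg]; congr 1; ring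
    rw [e, abs_neg, abs_of_nonneg h2]
    calc -α / Real.pi = 2 / Real.pi * (-α / 2) := by ring
      _ ≤ Real.sin (-α / 2) := h1

/-- The resolving kernel `D_M(α) := π / max(|α|, π/M)` (= `min(M, π/|α|)` for `α ≠ 0`, `= M` at `α = 0`). -/
noncomputable def dirichletBound (M : ℕ) (α : ℝ) : ℝ := Real.pi / max |α| (Real.pi / M)

/-- `D_M(α) ≥ 0`. -/
theorem dirichletBound_nonneg (M : ℕ) (α : ℝ) : 0 ≤ dirichletBound M α := by
  unfold dirichletBound
  exact div_nonneg Real.pi_pos.le ((abs_nonneg α).trans (le_max_left _ _))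

/-- `D_M(α) ≤ M` (`M > 0`). -/
theorem dirichletBound_le_card {M : ℕ} (hM : 0 < M) (α : ℝ) : dirichletBound M α ≤ M := by
  unfold dirichletBound
  have hπ := Real.pi_pos
  have hM' : (0 : ℝ) < M := by exact_mod_cast hM
  calc Real.pi / max |α| (Real.pi / M) ≤ Real.pi / (Real.pi / M) :=
        div_le_div_of_nonneg_left hπ.le (by positivity) (le_max_right _ _)
    _ = M := by field_simp

/-- `D_M(α) ≤ π/|α|` for `α ≠ 0`. -/
theorem dirichletBound_le_div {M : ℕ} {α : ℝ} (hα : α ≠ 0) : dirichletBound M α ≤ Real.pi / |α| := by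
  unfold dirichletBound
  exact div_le_div_of_nonneg_left Real.pi_pos.le (abs_pos.2 hα) (le_max_left _ _)

/-- **Resolved/unresolved bound.** For `|α| ≤ π` and `M ≥ 1`:
`|Σ_{n ∈ [N, N+M)} cos((n+½)α)| ≤ D_M(α)`. -/
theorem abs_sum_cos_le_dirichletBound {α : ℝ} (hα : |α| ≤ Real.pi) (N : ℕ) {M : ℕ} (hM : 0 < M) :
    |∑ n ∈ Finset.Ico N (N + M), Real.cos (((n : ℝ) + 1 / 2) * α)| ≤ dirichletBound M α := by
  have hπ := Real.pi_pos
  have hM' : (0 : ℝ) < M := by exact_mod_cast hM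
  unfold dirichletBound
  rcases le_or_gt |α| (Real.pi / M) with hsmall | hbig
  · rw [max_eq_right hsmall]
    calc |∑ n ∈ Finset.Ico N (N + M), Real.cos (((n : ℝ) + 1 / 2) * α)| ≤ M := abs_sum_cos_le α N M
      _ = Real.pi / (Real.pi / M) := by field_simp
  · rw [max_eq_left hbig.le]
    have hα0 : 0 < |α| := lt_of_le_of_lt (by positivity) hbig
    have hsin : |α| / Real.pi ≤ |Real.sin (α / 2)| := abs_div_pi_le_abs_sin_half hα
    have hsin0 : 0 < |Real.sin (α / 2)| := lt_of_lt_of_le (by positivity) hsin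
    have h1 := abs_sin_half_mul_abs_sum_cos_le α N M
    set S := ∑ n ∈ Finset.Ico N (N + M), Real.cos (((n : ℝ) + 1 / 2) * α) with hS
    have hS1 : |S| ≤ 1 / |Real.sin (α / 2)| := by
      rw [le_div_iff₀ hsin0, mul_comm]
      exact h1
    have hS2 : 1 / |Real.sin (α / 2)| ≤ Real.pi / |α| := by
      have := one_div_le_one_div_of_le (by positivity : 0 < |α| / Real.pi) hsin
      rwa [one_div_div] at this
    exact hS1.trans hS2

/-- **Pair lemma.** For `θ, θ' ∈ (0, π/2]` and `M ≥ 1`: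
`|Σ_{n ∈ [N, N+M)} sin((n+½)θ) sin((n+½)θ')| ≤ (D_M(θ − θ') + D_M(θ + θ'))/2`. -/
theorem abs_sum_sin_mul_sin_le {θ θ' : ℝ} (hθ : 0 < θ) (hθ1 : θ ≤ Real.pi / 2) (hθ' : 0 < θ')
    (hθ'1 : θ' ≤ Real.pi / 2) (N : ℕ) {M : ℕ} (hM : 0 < M) :
    |∑ n ∈ Finset.Ico N (N + M), Real.sin (((n : ℝ) + 1 / 2) * θ) * Real.sin (((n : ℝ) + 1 / 2) * θ')|
      ≤ (dirichletBound M (θ - θ') + dirichletBound M (θ + θ')) / 2 := by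
  have e : ∑ n ∈ Finset.Ico N (N + M), Real.sin (((n : ℝ) + 1 / 2) * θ) * Real.sin (((n : ℝ) + 1 / 2) * θ')
      = (1 / 2) * (∑ n ∈ Finset.Ico N (N + M), Real.cos (((n : ℝ) + 1 / 2) * (θ - θ'))
          - ∑ n ∈ Finset.Ico N (N + M), Real.cos (((n : ℝ) + 1 / 2) * (θ + θ'))) := by
    rw [← Finset.sum_sub_distrib, Finset.mul_sum]
    refine Finset.sum_congr rfl fun n _ ↦ ?_
    have h := Real.two_mul_sin_mul_sin (((n : ℝ) + 1 / 2) * θ) (((n : ℝ) + 1 / 2) * θ')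
    rw [show ((n : ℝ) + 1 / 2) * θ - ((n : ℝ) + 1 / 2) * θ' = ((n : ℝ) + 1 / 2) * (θ - θ') by ring,
      show ((n : ℝ) + 1 / 2) * θ + ((n : ℝ) + 1 / 2) * θ' = ((n : ℝ) + 1 / 2) * (θ + θ') by ring] at h
    linarith
  rw [e, abs_mul, abs_of_pos (by norm_num : (0 : ℝ) < 1 / 2)]
  have hπ := Real.pi_pos
  have h1 := abs_sum_cos_le_dirichletBound (α := θ - θ') (by rw [abs_le]; constructor <;> linarith) N hM
  have h2 := abs_sum_cos_le_dirichletBound (α := θ + θ') (by rw [abs_le]; constructor <;> linarith) N hM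
  have h3 := abs_sub (∑ n ∈ Finset.Ico N (N + M), Real.cos (((n : ℝ) + 1 / 2) * (θ - θ')))
    (∑ n ∈ Finset.Ico N (N + M), Real.cos (((n : ℝ) + 1 / 2) * (θ + θ')))
  linarith

/-- **THE ENGINE (mean-square bound for clustered frequencies).** For phases `θ_j ∈ (0, π/2]`,
real amplitudes `a_j` and a block `n ∈ [N, N+M)` (`M ≥ 1`):
`Σ_n (Σ_j a_j sin((n+½)θ_j))² ≤ Σ_{j,k} |a_j||a_k| (D_M(θ_j − θ_k) + D_M(θ_j + θ_k))/2`,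
with `D_M(α) = π/max(|α|, π/M) ≤ min(M, π/|α|)`. -/
theorem sum_sq_le {ι : Type*} (s : Finset ι) (a θ : ι → ℝ)
    (hθ : ∀ j ∈ s, 0 < θ j ∧ θ j ≤ Real.pi / 2) (N : ℕ) {M : ℕ} (hM : 0 < M) :
    ∑ n ∈ Finset.Ico N (N + M), (∑ j ∈ s, a j * Real.sin (((n : ℝ) + 1 / 2) * θ j)) ^ 2
      ≤ ∑ j ∈ s, ∑ k ∈ s, |a j| * |a k|
          * ((dirichletBound M (θ j - θ k) + dirichletBound M (θ j + θ k)) / 2) := by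
  have expand : ∀ n : ℕ, (∑ j ∈ s, a j * Real.sin (((n : ℝ) + 1 / 2) * θ j)) ^ 2
      = ∑ j ∈ s, ∑ k ∈ s, a j * a k
          * (Real.sin (((n : ℝ) + 1 / 2) * θ j) * Real.sin (((n : ℝ) + 1 / 2) * θ k)) := by
    intro n
    rw [sq, Finset.sum_mul_sum]
    refine Finset.sum_congr rfl fun j _ ↦ Finset.sum_congr rfl fun k _ ↦ by ring
  simp_rw [expand]
  rw [Finset.sum_comm]
  refine Finset.sum_le_sum fun j hj ↦ ?_
  rw [Finset.sum_comm]
  refine Finset.sum_le_sum fun k hk ↦ ?_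
  rw [← Finset.mul_sum]
  obtain ⟨hj0, hj1⟩ := hθ j hj
  obtain ⟨hk0, hk1⟩ := hθ k hk
  have hpair := abs_sum_sin_mul_sin_le hj0 hj1 hk0 hk1 N hM
  calc a j * a k * ∑ n ∈ Finset.Ico N (N + M),
          Real.sin (((n : ℝ) + 1 / 2) * θ j) * Real.sin (((n : ℝ) + 1 / 2) * θ k)
      ≤ |a j * a k * ∑ n ∈ Finset.Ico N (N + M),
          Real.sin (((n : ℝ) + 1 / 2) * θ j) * Real.sin (((n : ℝ) + 1 / 2) * θ k)| := le_abs_self _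
    _ = |a j| * |a k| * |∑ n ∈ Finset.Ico N (N + M),
          Real.sin (((n : ℝ) + 1 / 2) * θ j) * Real.sin (((n : ℝ) + 1 / 2) * θ k)| := by
        rw [abs_mul, abs_mul]
    _ ≤ |a j| * |a k| * ((dirichletBound M (θ j - θ k) + dirichletBound M (θ j + θ k)) / 2) :=
        mul_le_mul_of_nonneg_left hpair (by positivity)

/-- Coarse corollary: `Σ_n (Σ_j a_j sin((n+½)θ_j))² ≤ Σ_{j,k} |a_j||a_k| D_M(θ_j − θ_k)`
(since `D_M(θ_j + θ_k) ≤ D_M(θ_j − θ_k)`). -/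
theorem sum_sq_le' {ι : Type*} (s : Finset ι) (a θ : ι → ℝ)
    (hθ : ∀ j ∈ s, 0 < θ j ∧ θ j ≤ Real.pi / 2) (N : ℕ) {M : ℕ} (hM : 0 < M) :
    ∑ n ∈ Finset.Ico N (N + M), (∑ j ∈ s, a j * Real.sin (((n : ℝ) + 1 / 2) * θ j)) ^ 2
      ≤ ∑ j ∈ s, ∑ k ∈ s, |a j| * |a k| * dirichletBound M (θ j - θ k) := by
  refine (sum_sq_le s a θ hθ N hM).trans (Finset.sum_le_sum fun j hj ↦ Finset.sum_le_sum fun k hk ↦ ?_)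
  have hle : dirichletBound M (θ j + θ k) ≤ dirichletBound M (θ j - θ k) := by
    unfold dirichletBound
    have hπ := Real.pi_pos
    refine div_le_div_of_nonneg_left hπ.le (lt_of_lt_of_le (by positivity) (le_max_right _ _)) ?_
    refine max_le_max ?_ le_rfl
    obtain ⟨hj0, -⟩ := hθ j hj
    obtain ⟨hk0, -⟩ := hθ k hk
    rw [abs_of_pos (by linarith : 0 < θ j + θ k), abs_le]
    constructor <;> linarith
  have h0 : 0 ≤ |a j| * |a k| := by positivity
  nlinarith [dirichletBound_nonneg M (θ j - θ k), dirichletBound_nonneg M (θ j + θ k)]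

end MeanSquare

end Summit.RiemannHypothesis.RiemannHypothesis.Theorems.Splittings.LiIncrMeanSquare

end
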